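import Literature.AlgebraicGeometry.HodgeTheory.Sl2IsotypicLetters
import Mathlib.LinearAlgebra.TensorProduct.Pi
import HarnessLib

/-!
# Word-model lemmas for `𝔰𝔩₂`-isotypic Hodge classes: the colourwise first fundamental theorem for abstract letters,
# descent for coefficient functions, the determinant tensor, kind signatures (Gordon §3; Deligne LNM 900 I §3)

Family `hodge`, layer `Literature/AlgebraicGeometry/HodgeTheory`.  Cell `pub-hodgecm2` (COR-CM), seat `b27`, count-neutral
lane MT-RANK-FOUR-DIVISORS; UNCONDITIONAL, no use of HC_CM, no step towards a summit statement; everything proved, no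
definition, no named fact (D-0026).  SETTING AND NOTATION (`X`, `H = H¹(X(ℂ); ℚ)` with `dim Lie Hg ≤ 3`,
`Lie Hg ⊄ End_Hdg`, i.e. `X` not of CM type with `dim MT(H¹X) ≤ 4`; graded basis `e`, `P`, `X₀`, `E`, `F`, `Θ′ = 2P − 1`,
`α`; the pair basis `b`; `B` with slots `g` over `X` and its letters) as in the module docstring of
`HodgeTheory/Sl2IsotypicLetters`.

THIS FILE (word model and divisor classes; the letters `y : ι × Fin 2 → H¹(B(ℂ); ℂ)` are ABSTRACT):
* §1 `sum_cupPowOne_pairWord_mem_of_cross`, `sum_polytabloid_smul_mem_of_cross`,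
  **`wordEval_mem_divisorClassesSpan_of_wordRaise_eq_zero_of_cross`** — the tree's (E8/E9) evaluation of
  `NonCMEllipticCurvePowersHodgeClasses` with the crossed-class lemma replaced by the HYPOTHESIS that the crossed classes
  `y(i,0) ⌣ y(j,1) + y(j,0) ⌣ y(i,1)` are combinations of rational `(1,1)`-classes: a colour-balanced coefficient function
  killed slice-wise by the raising operator evaluates into `Dᵖ(B) ⊗ ℂ` (first fundamental theorem for `SL₂`,
  `mem_span_polytabloid_rect_of_wordRaise_eq_zero`).
* §2 `mem_span_ratCast_of_forall_eq_zero` — DESCENT: a complex solution of rational linear conditions on `ι → ℂ` is a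
  complex combination of rational solutions (Mathlib `TensorProduct.piScalarRight`, the tree's `mem_baseChange_iInf_ker`).
* §3 `wordDer_single_sub_single_eq_trace_smul` (the determinant tensor `x ⊗ y − y ⊗ x` is an eigenvector of `D(N)` with
  eigenvalue `tr N`), `wordDer_wordSlice_detCoeff_eq_zero`, `sum_wordContent_mul_kindSign`,
  `wordContent_eq_one_of_wordDer_kindDiag_eq_zero`, `wordDer_toMatrix_eq_zero_of_mem_spanC` (`𝔤_ℂ` kills what `𝔤` kills).

## References

* [Gordon1997] B. B. Gordon, *A survey of the Hodge conjecture for abelian varieties*, App. B of Lewis, CRM Monogr.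
  Ser. 10 (1999) = arXiv:alg-geom/9709030 (held `paper:arxiv-alg-geom_9709030`): §3, §7.3.2 (Murty: type (H); non-CM
  elliptic curves and QM abelian surfaces), Thm. 7.5 (Murty 1984 [B.82] / Hazama 1984 [B.47]), Def. 7.6.
* [Deligne1982HodgeCycles] P. Deligne, *Hodge cycles on abelian varieties*, LNM 900 (1982), I §3 (proof of Prop. 3.4).
* [vanGeemen1994HodgeAV] B. van Geemen, *An introduction to the Hodge conjecture for abelian varieties*, LNM 1594
  (1994), §2.4–2.5, 3.3, Lemma 3.7, Thm. 4.3.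
* [GoodmanWallachGTM255] R. Goodman, N. R. Wallach, GTM 255 (2009), §4.1.1, Thm. 5.3.3.
* [FultonHarris1991] W. Fulton, J. Harris, *Representation Theory*, GTM 129 (1991), Lecture 11 (§11.1).
-/

noncomputable section

open scoped TensorProduct

namespace Literature.AlgebraicGeometry.HodgeTheory

open Literature.AlgebraicTopology.SingularHomology
open Literature.AlgebraicGeometry.Motives
open Literature.AlgebraicGeometry.Motives.HodgeStructure
open Literature.Barriers.HodgeConjecture
open Literature.RepresentationTheory.GeneralLinear
open Literature.NumberTheory.DiophantineGeometry

/-! ### §1 The colourwise first fundamental theorem for abstract letters: invariant coefficient functions evaluate into `D• ⊗ ℂ` -/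

section Evaluation

variable {B : AbelianVariety ℂ} {ι : Type*}

/-- **(E9) The sum over column exchanges of the pair words is a product of crossed classes, hence in
`Dᵐ ⊗ ℂ`** — for ARBITRARY letters `y : ι × Fin 2 → H¹(B(ℂ); ℂ)` whose crossed classes
`y(i,0) ⌣ y(j,1) + y(j,0) ⌣ y(i,1)` are combinations of rational `(1,1)`-classes:
`∑_S m_{2m}(pairWord y I J S) = ∏_c ψ_{I c, J c} ∈ Dᵐ(B) ⊗ ℂ` (the tree's `sum_cupPowOne_pairWord_mem` for the
letters of an elliptic curve, with the crossed-class lemma replaced by the hypothesis `hcross`).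
[cite: Gordon1997, §3 (proof of the Theorem)] [cite: GoodmanWallachGTM255, Thm. 5.3.3] -/
theorem sum_cupPowOne_pairWord_mem_of_cross (y : ι × Fin 2 → complexBetti B.X 1)
    (hcross : ∀ i j, cupProduct (rfl : 1 + 1 = 2) (y (i, 0)) (y (j, 1)) +
        cupProduct (rfl : 1 + 1 = 2) (y (j, 0)) (y (i, 1)) ∈
      Submodule.span ℂ {b : complexBetti B.X 2 | IsRationalClass b ∧ IsOfHodgeType B.dim B.X 2 1 1 b}) :
    ∀ (m : ℕ) (I J : Fin m → ι),
      ∑ S : Fin m → Bool, cupPowOne ℂ (Motives.ComplexPoints B.X) (2 * m) (pairWord y I J S) ∈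
        divisorClassesSpan B.X B.dim m
  | 0, I, J => by
    rw [Fintype.sum_unique]
    change cupPowOne ℂ (Motives.ComplexPoints B.X) 0 _ ∈ _
    rw [cupPowOne_zero]
    exact Submodule.subset_span (mem_divisorMonomials_zero.2 rfl)
  | m + 1, I, J => by
    have IH := sum_cupPowOne_pairWord_mem_of_cross y hcross m (Fin.tail I) (Fin.tail J)
    have h2 : (2 : ℕ) + 2 * m = 2 * (m + 1) := by ring
    have hP0 : ∀ (b : Bool) (S' : Fin m → Bool),
        pickSlot I J (Fin.cons b S' : Fin (m + 1) → Bool) 0 0 = (bif b then J 0 else I 0) := by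
      intro b S'
      cases b <;> simp [pickSlot]
    have hP1 : ∀ (b : Bool) (S' : Fin m → Bool),
        pickSlot I J (Fin.cons b S' : Fin (m + 1) → Bool) 0 1 = (bif b then I 0 else J 0) := by
      intro b S'
      cases b <;> simp [pickSlot]
    have hterm : ∀ (b : Bool) (S' : Fin m → Bool),
        cupPowOne ℂ (Motives.ComplexPoints B.X) (2 * (m + 1)) (pairWord y I J (Fin.cons b S')) =
          cupProduct h2 (cupProduct (rfl : 1 + 1 = 2) (y (bif b then J 0 else I 0, 0))
            (y (bif b then I 0 else J 0, 1)))
            (cupPowOne ℂ (Motives.ComplexPoints B.X) (2 * m) (pairWord y (Fin.tail I) (Fin.tail J) S')) := by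
      intro b S'
      have hw : pairWord y I J (Fin.cons b S') = (Fin.cons (y (bif b then J 0 else I 0, 0))
          (Fin.cons (y (bif b then I 0 else J 0, 1))
            (pairWord y (Fin.tail I) (Fin.tail J) S')) : Fin (2 * m + 1 + 1) → _) := by
        funext t
        rw [pairWord_succ_apply, hP0, hP1, Fin.tail_cons]
      rw [hw, cupPowOne_cons_cons]
    have hsum : ∑ x : Bool × (Fin m → Bool), cupPowOne ℂ (Motives.ComplexPoints B.X) (2 * (m + 1))
        (pairWord y I J ((Fin.consEquiv fun _ : Fin (m + 1) => Bool) x)) =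
        cupProduct h2 (∑ b : Bool, cupProduct (rfl : 1 + 1 = 2) (y (bif b then J 0 else I 0, 0))
          (y (bif b then I 0 else J 0, 1)))
          (∑ S' : Fin m → Bool, cupPowOne ℂ (Motives.ComplexPoints B.X) (2 * m)
            (pairWord y (Fin.tail I) (Fin.tail J) S')) := by
      rw [Fintype.sum_prod_type, map_sum (cupProduct h2), LinearMap.sum_apply]
      refine Finset.sum_congr rfl fun b _ => ?_
      rw [map_sum (cupProduct h2 _)]
      exact Finset.sum_congr rfl fun S' _ => hterm b S'
    rw [← (Fin.consEquiv fun _ : Fin (m + 1) => Bool).sum_comp, hsum]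
    refine cupProduct_mem_divisorClassesSpan_succ_left h2 ?_ IH
    rw [Fintype.sum_bool, add_comm]
    exact hcross (I 0) (J 0)

/-- **(E9) The evaluation of every rectangular polytabloid on such letters lies in `Dᵖ(B) ⊗ ℂ`.**
[cite: Gordon1997, §3 (proof of the Theorem)] [cite: GoodmanWallachGTM255, Thm. 5.3.3] -/
theorem sum_polytabloid_smul_mem_of_cross (y : ι × Fin 2 → complexBetti B.X 1)
    (hcross : ∀ i j, cupProduct (rfl : 1 + 1 = 2) (y (i, 0)) (y (j, 1)) +
        cupProduct (rfl : 1 + 1 = 2) (y (j, 0)) (y (i, 1)) ∈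
      Submodule.span ℂ {b : complexBetti B.X 2 | IsRationalClass b ∧ IsOfHodgeType B.dim B.X 2 1 1 b})
    {p : ℕ} (T : StdFilling (2 * p) (twoRowRect p)) (u : Fin (2 * p) → ι) :
    ∑ ε : Word 2 (2 * p), T.polytabloid ℂ (twoRowRect_fst_lt p) ε •
        cupPowOneAlt ℂ (Motives.ComplexPoints B.X) (2 * p) (fun s => y (u s, ε s)) ∈
      divisorClassesSpan B.X B.dim p := by
  rw [sum_polytabloid_smul_eq_sum_colStab, sum_colStab_eq_sign_smul_sum_pairWord]
  refine Submodule.smul_mem _ _ ?_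
  simp only [cupPowOneAlt_apply]
  exact sum_cupPowOne_pairWord_mem_of_cross y hcross p _ _

/-- **(E8 + E9) The colourwise first fundamental theorem, abstract letters.**  For letters
`y : ι × Fin 2 → H¹(B(ℂ); ℂ)` with divisorial crossed classes: a coefficient function `a` supported on
colour-balanced words (`p` letters of each colour) whose every slice along a slot word is killed by the raising
operator `E_{01}` evaluates into `Dᵖ(B) ⊗ ℂ` — by the first fundamental theorem for `SL₂`
(`mem_span_polytabloid_rect_of_wordRaise_eq_zero`) each slice is a combination of rectangular polytabloids, whose
evaluations are products of crossed classes.  Gordon §3 / §7.3.2: "the invariants are generated by those of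
degree `2`". [cite: Gordon1997, §3 and §7.3.2] [cite: GoodmanWallachGTM255, Thm. 5.3.3] -/
theorem wordEval_mem_divisorClassesSpan_of_wordRaise_eq_zero_of_cross [Fintype ι]
    (y : ι × Fin 2 → complexBetti B.X 1)
    (hcross : ∀ i j, cupProduct (rfl : 1 + 1 = 2) (y (i, 0)) (y (j, 1)) +
        cupProduct (rfl : 1 + 1 = 2) (y (j, 0)) (y (i, 1)) ∈
      Submodule.span ℂ {b : complexBetti B.X 2 | IsRationalClass b ∧ IsOfHodgeType B.dim B.X 2 1 1 b})
    {p : ℕ} {a : (Fin (2 * p) → ι × Fin 2) → ℂ}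
    (ha : ∀ w, a w ≠ 0 → ∀ r : Fin 2, wordContent (fun t => (w t).2) r = p)
    (hraise : ∀ u : Fin (2 * p) → ι, wordRaise ℂ 0 1 (wordSlice a u) = 0) :
    wordEval (cupPowOneAlt ℂ (Motives.ComplexPoints B.X) (2 * p)) y a ∈ divisorClassesSpan B.X B.dim p := by
  classical
  rw [wordEval_eq_sum_wordSlice]
  refine Submodule.sum_mem _ fun u _ => ?_
  have hslice : wordSlice a u ∈ Submodule.span ℂ
      (Set.range fun T : StdFilling (2 * p) (twoRowRect p) => T.polytabloid ℂ (twoRowRect_fst_lt p)) :=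
    mem_span_polytabloid_rect_of_wordRaise_eq_zero ℂ p (hraise u) (fun ε hε r => ha _ hε r)
  set L : (Word 2 (2 * p) → ℂ) →ₗ[ℂ] complexBetti B.X (2 * p) :=
    Fintype.linearCombination ℂ (fun ε : Word 2 (2 * p) =>
      cupPowOneAlt ℂ (Motives.ComplexPoints B.X) (2 * p) (fun s => y (u s, ε s))) with hL
  have hLapply : ∀ c' : Word 2 (2 * p) → ℂ, L c' = ∑ ε, c' ε •
      cupPowOneAlt ℂ (Motives.ComplexPoints B.X) (2 * p) (fun s => y (u s, ε s)) :=
    fun c' => Fintype.linearCombination_apply ℂ _ c'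
  have hgoal : ∑ ε : Word 2 (2 * p), wordSlice a u ε •
      cupPowOneAlt ℂ (Motives.ComplexPoints B.X) (2 * p) (fun s => y (u s, ε s)) = L (wordSlice a u) :=
    (hLapply _).symm
  rw [hgoal]
  have hle : Submodule.span ℂ
      (Set.range fun T : StdFilling (2 * p) (twoRowRect p) => T.polytabloid ℂ (twoRowRect_fst_lt p)) ≤
      (divisorClassesSpan B.X B.dim p).comap L := by
    refine Submodule.span_le.2 ?_
    rintro _ ⟨T, rfl⟩
    change L (T.polytabloid ℂ _) ∈ divisorClassesSpan B.X B.dim p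
    rw [hLapply]
    exact sum_polytabloid_smul_mem_of_cross y hcross T u
  exact hle hslice

end Evaluation

/-! ### §2 Descent for coefficient functions: complex solutions of rational linear conditions -/

section Descent

/-- **Descent for coefficient functions.**  Let `p_d` be rational linear functionals on `ι → ℚ` (`ι` finite) and
`P_d` complex linear functionals on `ι → ℂ` extending them (`P_d (q ⊗ 1) = p_d q`).  A complex-valued function
`a : ι → ℂ` with `P_d a = 0` for all `d` lies in the complex span of the RATIONAL solutions `q` (`p_d q = 0` for all
`d`): through `ℂ ⊗_ℚ (ι → ℚ) ≅ (ι → ℂ)` (Mathlib `TensorProduct.piScalarRight`), the coordinates of `a` in a `ℚ`-basis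
of `ℂ` are rational solutions (the tree's `mem_baseChange_iInf_ker`).  Deligne, LNM 900 I §3: the invariants of a
`ℚ`-group are defined over `ℚ`. [cite: Deligne1982HodgeCycles, I §3 (proof of Prop. 3.4)] -/
theorem mem_span_ratCast_of_forall_eq_zero {ι δ : Type*} [Fintype ι] [DecidableEq ι]
    (p : δ → ((ι → ℚ) →ₗ[ℚ] ℚ)) (P : δ → ((ι → ℂ) →ₗ[ℂ] ℂ))
    (hP : ∀ d (q : ι → ℚ), P d (fun i => algebraMap ℚ ℂ (q i)) = algebraMap ℚ ℂ (p d q))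
    {a : ι → ℂ} (ha : ∀ d, P d a = 0) :
    a ∈ Submodule.span ℂ ((fun q : ι → ℚ => fun i => algebraMap ℚ ℂ (q i)) '' {q | ∀ d, p d q = 0}) := by
  classical
  set κ : ℂ ⊗[ℚ] (ι → ℚ) ≃ₗ[ℂ] (ι → ℂ) := TensorProduct.piScalarRight ℚ ℂ ℂ ι with hκ
  have hκ1 : ∀ q : ι → ℚ, κ ((1 : ℂ) ⊗ₜ[ℚ] q) = fun i => algebraMap ℚ ℂ (q i) := fun q => by
    funext i
    rw [hκ, TensorProduct.piScalarRight_apply, TensorProduct.piScalarRightHom_tmul]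
    change q i • (1 : ℂ) = _
    rw [Rat.smul_one_eq_cast, eq_ratCast]
  obtain ⟨ξ, rfl⟩ := κ.surjective a
  -- the complexified rational conditions vanish on `ξ`
  have hker : ∀ d, (p d).baseChange ℂ ξ = 0 := by
    intro d
    have hmaps : ∀ ζ : ℂ ⊗[ℚ] (ι → ℚ),
        (TensorProduct.AlgebraTensorModule.rid ℚ ℂ ℂ) ((p d).baseChange ℂ ζ) = P d (κ ζ) := by
      intro ζ
      induction ζ using TensorProduct.induction_on with
      | zero => simp
      | tmul c q =>
        have hcq : κ (c ⊗ₜ[ℚ] q) = c • κ ((1 : ℂ) ⊗ₜ[ℚ] q) := by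
          rw [← map_smul, TensorProduct.smul_tmul', smul_eq_mul, mul_one]
        rw [LinearMap.baseChange_tmul, TensorProduct.AlgebraTensorModule.rid_tmul, hcq, map_smul, hκ1, hP,
          smul_eq_mul, Algebra.smul_def, mul_comm]
      | add x y hx hy => rw [map_add, map_add, hx, hy, map_add, map_add]
    have h := hmaps ξ
    rw [ha d] at h
    exact (TensorProduct.AlgebraTensorModule.rid ℚ ℂ ℂ).map_eq_zero_iff.1 h
  have hmem := mem_baseChange_iInf_ker p hker
  have h := map_mem_span_of_mem_baseChange κ.toLinearMap _ hmem
  refine Submodule.span_mono ?_ h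
  rintro _ ⟨q, hq, rfl⟩
  refine ⟨q, fun d => ?_, (hκ1 q).symm⟩
  have hq' := (Submodule.mem_iInf _).1 hq d
  rwa [LinearMap.mem_ker] at hq'

end Descent

/-! ### §3 The determinant tensor, kind signatures, and `𝔤_ℂ` kills what `𝔤` kills -/

section WordComputations

variable {K : Type*} [Field K]

/-- **The determinant tensor `x ⊗ y − y ⊗ x` is an eigenvector of every `D(N)`, `N ∈ 𝔤𝔩₂`, with eigenvalue
`tr N`** (so it is killed by `𝔰𝔩₂`): on `Word 2 2`, `D(N)(δ_{01} − δ_{10}) = (N₀₀ + N₁₁)(δ_{01} − δ_{10})`.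
[cite: GoodmanWallachGTM255, §4.1.1] [cite: FultonHarris1991, Lecture 11 (§11.1)] -/
theorem wordDer_single_sub_single_eq_trace_smul (N : Matrix (Fin 2) (Fin 2) K) :
    wordDer K N ((Pi.single ![0, 1] 1 : Word 2 2 → K) - Pi.single ![1, 0] 1) =
      (N 0 0 + N 1 1) • ((Pi.single ![0, 1] 1 : Word 2 2 → K) - Pi.single ![1, 0] 1) := by
  set f : Word 2 2 → K := (Pi.single ![0, 1] 1 : Word 2 2 → K) - Pi.single ![1, 0] 1 with hf
  have hne : ∀ c d : Fin 2, (![c, d] : Word 2 2) = ![0, 1] ↔ c = 0 ∧ d = 1 := fun c d => by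
    constructor
    · intro h; exact ⟨by simpa using congrFun h 0, by simpa using congrFun h 1⟩
    · rintro ⟨rfl, rfl⟩; rfl
  have hne' : ∀ c d : Fin 2, (![c, d] : Word 2 2) = ![1, 0] ↔ c = 1 ∧ d = 0 := fun c d => by
    constructor
    · intro h; exact ⟨by simpa using congrFun h 0, by simpa using congrFun h 1⟩
    · rintro ⟨rfl, rfl⟩; rfl
  have hupd0 : ∀ (c d x : Fin 2), Function.update (![c, d] : Word 2 2) 0 x = ![x, d] := fun c d x => by
    funext t; fin_cases t <;> simp
  have hupd1 : ∀ (c d x : Fin 2), Function.update (![c, d] : Word 2 2) 1 x = ![c, x] := fun c d x => by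
    funext t; fin_cases t <;> simp
  have hval : ∀ c d : Fin 2, f ![c, d] =
      (if (![c, d] : Word 2 2) = ![0, 1] then (1 : K) else 0) -
        (if (![c, d] : Word 2 2) = ![1, 0] then (1 : K) else 0) := fun c d => by
    rw [hf, Pi.sub_apply, Pi.single_apply, Pi.single_apply]
  have key : ∀ a b : Fin 2, wordDer K N f ![a, b] = (N 0 0 + N 1 1) * f ![a, b] := by
    intro a b
    rw [wordDer_apply]
    simp only [Fin.sum_univ_two, Matrix.cons_val_zero, Matrix.cons_val_one, hupd0, hupd1, hval, hne, hne']
    fin_cases a <;> fin_cases b <;> simp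
  funext ε
  have hε : ε = ![ε 0, ε 1] := by
    funext t
    fin_cases t <;> rfl
  rw [Pi.smul_apply, smul_eq_mul, hε]
  exact key _ _


/-- **Slices of the determinant coefficient function**: for letters `ι × Fin 2` and two slots `i, j`, the coefficient
function `δ_{(i,0)(j,1)} − δ_{(i,1)(j,0)}` has, along every slot word, a slice killed by every trace-free `2 × 2` matrix
(its slice along `(i, j)` is the determinant tensor, all other slices vanish). [cite: GoodmanWallachGTM255, §4.1.1] -/
theorem wordDer_wordSlice_detCoeff_eq_zero {ι : Type*} [DecidableEq ι] (i j : ι) (U : Fin 2 → ι)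
    (N₀ : Matrix (Fin 2) (Fin 2) K) (htr : N₀ 0 0 + N₀ 1 1 = 0) :
    wordDer K N₀ (wordSlice ((Pi.single ![(i, (0 : Fin 2)), (j, 1)] 1 : (Fin 2 → ι × Fin 2) → K) -
      Pi.single ![(i, (1 : Fin 2)), (j, 0)] 1) U) = 0 := by
  set w₁ : Fin 2 → ι × Fin 2 := ![(i, 0), (j, 1)] with hw₁
  set w₂ : Fin 2 → ι × Fin 2 := ![(i, 1), (j, 0)] with hw₂
  set a₂ : (Fin 2 → ι × Fin 2) → K := Pi.single w₁ 1 - Pi.single w₂ 1 with ha₂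
  by_cases hU : U = ![i, j]
  · have hs : wordSlice a₂ U = (Pi.single ![0, 1] 1 : Word 2 2 → K) - Pi.single ![1, 0] 1 := by
      funext ε
      rw [wordSlice_apply, ha₂, Pi.sub_apply, Pi.sub_apply, Pi.single_apply, Pi.single_apply, Pi.single_apply,
        Pi.single_apply]
      have hε : ε = ![ε 0, ε 1] := by funext t; fin_cases t <;> rfl
      have e1 : ((fun p => (U p, ε p)) = w₁) ↔ ε = ![0, 1] := by
        rw [hU, hw₁]
        constructor
        · intro h
          rw [hε]
          have h0 := congrFun h 0
          have h1 := congrFun h 1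
          simp only [Matrix.cons_val_zero, Matrix.cons_val_one, Prod.mk.injEq] at h0 h1
          rw [h0.2, h1.2]
        · intro h
          rw [h]
          funext t
          fin_cases t <;> rfl
      have e2 : ((fun p => (U p, ε p)) = w₂) ↔ ε = ![1, 0] := by
        rw [hU, hw₂]
        constructor
        · intro h
          rw [hε]
          have h0 := congrFun h 0
          have h1 := congrFun h 1
          simp only [Matrix.cons_val_zero, Matrix.cons_val_one, Prod.mk.injEq] at h0 h1
          rw [h0.2, h1.2]
        · intro h
          rw [h]
          funext t
          fin_cases t <;> rfl
      simp only [e1, e2]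
    rw [hs, wordDer_single_sub_single_eq_trace_smul, htr, zero_smul]
  · have hs : wordSlice a₂ U = 0 := by
      funext ε
      rw [wordSlice_apply, ha₂, Pi.sub_apply, Pi.zero_apply, Pi.single_apply, Pi.single_apply]
      have e1 : ¬ ((fun p => (U p, ε p)) = w₁) := fun h => hU (by
        funext t
        have ht := congrFun h t
        rw [hw₁] at ht
        fin_cases t
        · exact (Prod.mk.inj ht).1
        · exact (Prod.mk.inj ht).1)
      have e2 : ¬ ((fun p => (U p, ε p)) = w₂) := fun h => hU (by
        funext t
        have ht := congrFun h t
        rw [hw₂] at ht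
        fin_cases t
        · exact (Prod.mk.inj ht).1
        · exact (Prod.mk.inj ht).1)
      rw [if_neg e1, if_neg e2, sub_zero]
    rw [hs, map_zero]

/-- **The kind signature of a word**: `∑_ℓ #ℓ(ε) · (±1)_{kind ℓ} = #{kind 0} − #{kind 1}` (the eigenvalue of the
infinitesimal Hodge operator `diag(±1)` on the basis tensor `e_ε`). [cite: GoodmanWallachGTM255, §4.1.1]
[cite: vanGeemen1994HodgeAV, 3.3] -/
theorem sum_wordContent_mul_kindSign {N d : ℕ} (κ : Fin N → Fin 2) (ε : Word N d) :
    ∑ ℓ, (wordContent ε ℓ : ℂ) * (if κ ℓ = 0 then (1 : ℂ) else -1) =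
      (wordContent (fun t => κ (ε t)) 0 : ℂ) - wordContent (fun t => κ (ε t)) 1 := by
  classical
  rw [← Finset.sum_filter_add_sum_filter_not Finset.univ (fun ℓ : Fin N => κ ℓ = 0)]
  have hA : ∑ ℓ ∈ Finset.univ.filter (fun ℓ : Fin N => κ ℓ = 0),
      (wordContent ε ℓ : ℂ) * (if κ ℓ = 0 then (1 : ℂ) else -1) = (wordContent (fun t => κ (ε t)) 0 : ℂ) := by
    rw [Finset.sum_congr rfl (fun ℓ hℓ => by rw [if_pos (Finset.mem_filter.1 hℓ).2, mul_one]),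
      ← Nat.cast_sum, sum_wordContent_filter_kind κ ε 0]
  have hκ1 : ∀ ℓ : Fin N, ¬ κ ℓ = 0 ↔ κ ℓ = 1 := fun ℓ => by
    constructor
    · intro h
      rcases Fin.eq_zero_or_eq_succ (κ ℓ) with h0 | ⟨j, hj⟩
      · exact absurd h0 h
      · rw [hj]; exact congrArg Fin.succ (Fin.eq_zero j)
    · intro h h0; rw [h0] at h; exact Fin.zero_ne_one h
  have hB : ∑ ℓ ∈ Finset.univ.filter (fun ℓ : Fin N => ¬ κ ℓ = 0),
      (wordContent ε ℓ : ℂ) * (if κ ℓ = 0 then (1 : ℂ) else -1) = -(wordContent (fun t => κ (ε t)) 1 : ℂ) := by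
    rw [Finset.sum_congr rfl (fun ℓ hℓ => by rw [if_neg (Finset.mem_filter.1 hℓ).2, mul_neg, mul_one]),
      Finset.sum_neg_distrib, ← Nat.cast_sum]
    have hfilt : Finset.univ.filter (fun ℓ : Fin N => ¬ κ ℓ = 0) = Finset.univ.filter (fun ℓ : Fin N => κ ℓ = 1) :=
      Finset.filter_congr fun ℓ _ => hκ1 ℓ
    rw [hfilt, sum_wordContent_filter_kind κ ε 1]
  rw [hA, hB, sub_eq_add_neg]

/-- **A length-two word killed by `diag(±1 by kind)` with a non-zero coefficient has one letter of each kind.**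
[cite: vanGeemen1994HodgeAV, 3.3] -/
theorem wordContent_eq_one_of_wordDer_kindDiag_eq_zero {N : ℕ} (κ : Fin N → Fin 2) {c : Word N 2 → ℂ}
    (hc : wordDer ℂ (kindDiag κ) c = 0) {ε : Word N 2} (hε : c ε ≠ 0) (r : Fin 2) :
    wordContent (fun t => κ (ε t)) r = 1 := by
  have h := congrFun hc ε
  rw [kindDiag, wordDer_diagonal_apply_wordContent, Pi.zero_apply, mul_eq_zero, sum_wordContent_mul_kindSign] at h
  have h0 := h.resolve_right hε
  have hsum := sum_wordContent (fun t => κ (ε t))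
  rw [Fin.sum_univ_two] at hsum
  have h0' : (wordContent (fun t => κ (ε t)) 0 : ℂ) = wordContent (fun t => κ (ε t)) 1 := sub_eq_zero.1 h0
  have h0'' : wordContent (fun t => κ (ε t)) 0 = wordContent (fun t => κ (ε t)) 1 := by exact_mod_cast h0'
  fin_cases r
  · change wordContent (fun t => κ (ε t)) 0 = 1; omega
  · change wordContent (fun t => κ (ε t)) 1 = 1; omega

/-- `Lie Hg ⊗ ℂ` acts trivially, in the word model, on the complexification of a rational coefficient tensor killed by
`Lie Hg`: if the matrix of every `X ∈ 𝔤` kills the slices of `q`, so does the matrix of every `Y ∈ 𝔤_ℂ` (the condition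
is `ℂ`-linear in `Y`; the tree's `annCondC`). [cite: GoodmanWallachGTM255, §4.1.1] -/
theorem wordDer_toMatrix_eq_zero_of_mem_spanC {V : Type} [AddCommGroup V] [Module ℚ V] {M d m : ℕ}
    (eQ : Module.Basis (Fin M) ℚ V) {𝔤 : Submodule ℚ (Module.End ℚ V)} {q : (Fin d → Fin m × Fin M) → ℚ}
    (hq : ∀ X' ∈ 𝔤, ∀ u : Fin d → Fin m, wordDer ℚ (LinearMap.toMatrix eQ eQ X') (wordSlice q u) = 0)
    {Y : Module.End ℂ (ℂ ⊗[ℚ] V)} (hY : Y ∈ spanC 𝔤) (u : Fin d → Fin m) :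
    wordDer ℂ (LinearMap.toMatrix (Algebra.TensorProduct.basis ℂ eQ) (Algebra.TensorProduct.basis ℂ eQ) Y)
      (wordSlice (fun w => algebraMap ℚ ℂ (q w)) u) = 0 := by
  funext ε
  have hle : spanC 𝔤 ≤ LinearMap.ker (annCondC eQ (fun w => algebraMap ℚ ℂ (q w)) (u, ε)) := by
    rw [spanC, Submodule.span_le]
    rintro _ ⟨X', hX', rfl⟩
    rw [SetLike.mem_coe, LinearMap.mem_ker, annCondC_baseChange, annCond_apply, wordDerAt_const, hq X' hX' u,
      Pi.zero_apply, map_zero]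
  have h := hle hY
  rw [LinearMap.mem_ker, annCondC_apply, wordDerAt_const] at h
  rw [h, Pi.zero_apply]


end WordComputations


end Literature.AlgebraicGeometry.HodgeTheory

end
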